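import Summits.QuantumFields.BalabanUV.T4Continuum.Spine.NE9.DirectPairingEnd
import Summits.QuantumFields.BalabanUV.T4Continuum.Spine.NE9.DirectPairingCrossoverEffective

/-!
# T⁴ programme, spine estimate NE9 — THE KING ROUTE's E-SIDE END (C43) MADE EFFECTIVE: an explicit bound on the continuum-limit error after `K` steps
# from the re-indexed budget's four named slots, the bad-class weight and the window — census item C44 (d) of cell `pub-balaban-gaps`, seat ne9 (gen 13)

Cell `pub-balaban-gaps` (YM blitz G2, seat ne9, unit `pub-balaban-gaps-ne9-g13`; record `run/shared/lean/pub/pub-balaban-gaps/ne/NE9.md` §5 row C44).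
Summits-side bookkeeping over this seat's C43 END (`DirectPairingEnd.king_end_of_window`: profile + printed sizes + a King window + the T4-DAG's producers ⇒
`CauchySeq` + uniform convergence, QUALITATIVE) and C44 (a) (`DirectPairingCrossoverEffective`: the crossover slot made explicit).  NO definition; nothing of
Bałaban's asserted.

WHY.  C44 (a)–(c) made node U6 effective GIVEN King's matching shape with the crossover majorant as the whole remainder.  The cell's actual E-side END (C43)
feeds node U6 through the re-indexed term budget (`T4MatchingClosure.ReindexedBudget`: radius `r`, UV radius `u`, deviation `s`, UV constant `s₂`) and a
bad class of relative weight `W K = V·r₀^{m K}` along a King window `m`; its conclusion was `CauchySeq` only.  But every link of that chain is ALREADY an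
inequality in the tree: `DirectPairingEnd.kingMatching_of_goodClause` gives King's matching shape with the HYBRID remainder
`vol·hybridDelta vol δ W K = vol·δ K − log(1 − W K)`, `δ = (r + u) + (s + s₂)` (`T4MatchingClosure.goodClause_of_reindexed`), and
`DirectPairingCauchy.abs_genFun_sub_lim_le_of_unif` turns any such shape into `∣genFun Z K t − genFunLim Z t∣ ≤ 2·vol·hybridDelta`.  This file composes them:
* §1 `abs_genFun_sub_lim_le_hybrid`: under EXACTLY the hypotheses of `king_end_of_window`, for every `K` and `∣t∣ ≤ l₀`:
  `∣genFun Z K t − genFunLim Z t∣ ≤ 2·(vol·((r K + u K) + (s K + s₂ K)) − log(1 − V r₀^{m K}))` with `r K` = the King crossover majorant and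
  `s K = Cw·Σ_{j=K−m K}^{K} b_jΛ^{K−j} + s′ K` VERBATIM — the END's error is the budget's four slots plus the bad-class logarithm, nothing hidden in a limit.
* §2 `abs_genFun_sub_lim_le_end`: the same with the crossover slot bounded by C44 (a) (`crossoverE_le_window`, `crossoverR_le_window`) for every UV cut `N` and
  window bound `β`: `≤ 2·(vol·(E₁a^{N+1}∕(1−a) + Σ_{i≥N+1}R₁(b₀i)^{−κ₀∕2} + 2β·Σ_{n≤N}Λⁿ + w K + u K + Cw·Σ_{j=K−m K}^{K} b_jΛ^{K−j} + s′ K + s₂ K) − log(1 − V r₀^{m K}))`.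
* §3 `abs_genFun_sub_lim_le_end'`: with `V r₀^{m K} ≤ 1∕2` the bad-class logarithm is `≤ 2·V·r₀^{m K}` (`−log(1−x) ≤ 2x`, the tree's `DFI1995.neg_log_one_sub_le`
  re-derived inline from `Real.one_sub_inv_le_log_of_pos` to keep the import cone topic-local) — every slot linear.

VERDICT FOR THE ROW (census C44 (d)).  The E-side END of NE9-as-consumed on the King route is EFFECTIVE AS TYPED: after `K` steps the block observable's
generating function is within `2·vol·(explicit E∕R crossover part at any cut N + 2β(K−N)·Σ_{n≤N}Λⁿ + Cw·(window sum) + w_K + u_K + s′_K + s₂,K) + 4V·r₀^{m K}`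
of its limit, where the E-side enters ONLY through the profile `b` (window bound `β`, window sum) and everything else is a printed scalar or a T4-DAG owner's
rate (`w, u, s′, s₂`: NE7b, NE-R1, the other kinds; `V, r₀, m`: NE7b's bad-class budget and the King window).  With C44 (b): a geometric E-side envelope makes
the E-side's share exponentially small in `K`; the overall rate is then set by the slowest of the OWNERS' rates.  NOTHING new is owed; CLASSIFICATION OF NE9
UNCHANGED: WORK-bound (W1 = the one-step renormalization transformation as a Lean object; instance 0∕1).

HONEST FRAMING: bookkeeping for rung (B)+1 on ONE FIXED finite four-torus; elementary real analysis on hypothesis SHAPES (the cell's node-U5 design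
`ReindexedBudget`, NE7b's bad-class budget, King's window — the cell's located estimates, none in print for Bałaban's d = 4 procedure); (2.43)∕(2.44) are
Bałaban's printed Theorem 2 of [III], displayed as SHAPES and NOT proved here; (0.31) enters as the hypothesis `Step.Discrete031` (cell flag COND-BetaPertH);
every bound here is a MODEL-level formula, not a certified constant of Bałaban's; NE9 NOT PRINTED ∕ NOT PROVED; spine PROVED 0∕9 unchanged; NOT UV stability,
NOT the continuum limit, NOT infinite volume, NOT a mass gap, NOT Clay.  HONEST DEPENDENCY: continuum YM on T⁴ ⇐ BetaPertH ∧ nine spine estimates (0∕9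
proved); BetaPertH ⇐ (D1) ∧ (D4) ∧ CAP+tail.

References (TYPES only): [Balaban1988Convergent] = T. Bałaban, Commun. Math. Phys. **119** (1988) 243–285, Thm 2 (2.43)–(2.44) p. 263; [Balaban1987RG1] =
T. Bałaban, Commun. Math. Phys. **109** (1987) 249–301, (0.31) p. 259; [King1986] = C. King, Commun. Math. Phys. **102** (1986) 649–677, Thm 3.4 (3.9) p. 656,
(3.10)–(3.13) p. 656–657.
-/

namespace Summit.QuantumFields.BalabanUV.T4Continuum.NE9.DirectPairingEndEffective

open scoped BigOperators
open Finset Filter Topology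
open Literature.MathematicalPhysics.QuantumFieldTheory.Balaban1983to89
open T4CauchySum (genFun genFunLim)
open T4HybridMatching (hybridDelta mul_hybridDelta)
open T4MatchingClosure (ReindexedBudget goodClause_of_reindexed)
open Summit.QuantumFields.BalabanUV.T4Continuum.NE9.DirectPairingApex (tendsto_hybridDelta)
open Summit.QuantumFields.BalabanUV.T4Continuum.NE9.DirectPairingApexBudget (tendsto_reindexedDelta)
open Summit.QuantumFields.BalabanUV.T4Continuum.NE9.DirectPairingCauchy (abs_genFun_sub_lim_le_of_unif)
open Summit.QuantumFields.BalabanUV.T4Continuum.NE9.DirectPairingEnd (kingMatching_of_goodClause)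
open Summit.QuantumFields.BalabanUV.T4Continuum.NE9.DirectPairingCrossoverEffective (crossoverE_le_window crossoverR_le_window)

section End

variable {ι : Type*} [DecidableEq ι] {l₀ vol : ℝ} {Z : ℕ → ℝ → ℝ}
  {E₁ a Λ b₀ β' R₁ r₀ V Cw : ℝ} {κ₀ : ℕ} {g : ℕ → ℝ} {gs : ℕ → ℕ → ℝ} {b w u s' s₂ : ℕ → ℝ} {m : ℕ → ℕ}

/-! ## §1 The END's error at every `K`: the four budget slots plus the bad-class logarithm -/

/-- **THE E-SIDE END WITH ITS ERROR WRITTEN OUT.**  Under EXACTLY the hypotheses of `DirectPairingEnd.king_end_of_window` (profile `b → 0`, printed sizes,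
King window `m` with bad-class budget `V·r₀^{m K} < 1`, `→ 0`, window sum `→ 0`, the owners' rates `w, u, s′, s₂ → 0`, the dictionary, the bad-class
inequalities and the re-indexed budget with the crossover majorant ∕ window sum in its recent slots), for every `K` and `∣t∣ ≤ l₀`:
`∣genFun Z K t − genFunLim Z t∣ ≤ 2·(vol·((r K + u K) + (s K + s₂ K)) − log(1 − V·r₀^{m K}))` with `r K` the King crossover majorant and
`s K = Cw·Σ_{j=K−m K}^{K} b_jΛ^{K−j} + s′ K` — `kingMatching_of_goodClause` + `goodClause_of_reindexed` + `abs_genFun_sub_lim_le_of_unif` BY NAME (the limit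
exists by the qualitative END's inputs).  CONDITIONAL kernel theorem on hypothesis SHAPES. [cite: King1986, Thm 3.4 (3.9) p. 656, p. 657] [folklore] -/
theorem abs_genFun_sub_lim_le_hybrid (hvol : 0 < vol) (hl₀ : 0 ≤ l₀)
    (hb0 : ∀ j, 0 ≤ b j) (hb : Tendsto b atTop (𝓝 0)) (hE₁ : 0 ≤ E₁) (ha0 : 0 ≤ a) (ha1 : a < 1) (hΛ : 0 ≤ Λ)
    (hb₀ : 0 < b₀) (h031 : ∀ K, Step.Discrete031 b₀ β' K (g K) (gs K)) (hgs : ∀ K k, k ≤ K → 0 ≤ gs K k)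
    (hR₁ : 0 ≤ R₁) (hκ : 2 < κ₀)
    (hW1 : ∀ K, V * r₀ ^ m K < 1) (hWm : Tendsto (fun K => V * r₀ ^ m K) atTop (𝓝 0))
    (hwin : Tendsto (fun K => ∑ j ∈ Icc (K - m K) K, b j * Λ ^ (K - j)) atTop (𝓝 0))
    (hw : Tendsto w atTop (𝓝 0)) (hu : Tendsto u atTop (𝓝 0)) (hs' : Tendsto s' atTop (𝓝 0))
    (hs₂ : Tendsto s₂ atTop (𝓝 0))
    (T : ℕ → ℕ → Finset ι) (A B : ℕ → ℕ → ℝ → ι → ℝ) (Bad : ℕ → ℕ → ℝ → Finset ι)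
    (Cc Rr CcRec RrRec : ℕ → ℕ → ℝ → ι → ℝ) (ν c₀ : ℕ → ℕ → ℝ)
    (hZA : ∀ n K t, |t| ≤ l₀ → Z K t = ∑ τ ∈ T n K, A n K t τ)
    (hZB : ∀ n K t, |t| ≤ l₀ → Z (K + n) t = ∑ τ ∈ T n K, B n K t τ)
    (hpos : ∀ n K t, |t| ≤ l₀ → 0 < ∑ τ ∈ T n K, A n K t τ)
    (hBad : ∀ n K t, |t| ≤ l₀ → Bad n K t ⊆ T n K)
    (hA : ∀ n K t, |t| ≤ l₀ → ∀ τ ∈ T n K, 0 ≤ A n K t τ) (hB : ∀ n K t, |t| ≤ l₀ → ∀ τ ∈ T n K, 0 ≤ B n K t τ)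
    (hbadA : ∀ n K t, |t| ≤ l₀ → ∑ τ ∈ Bad n K t, A n K t τ ≤ V * r₀ ^ m K * ∑ τ ∈ T n K, A n K t τ)
    (hbadB : ∀ n K t, |t| ≤ l₀ → ∑ τ ∈ Bad n K t, B n K t τ ≤ V * r₀ ^ m K * ∑ τ ∈ T n K, B n K t τ)
    (hRB : ∀ n, ReindexedBudget l₀ vol (T n) (A n) (B n) (Bad n) (Cc n) (Rr n) (CcRec n) (RrRec n) (ν n) u s₂ (c₀ n)
      (fun K => (∑ p ∈ antidiagonal K, min (E₁ * a ^ p.2) (b p.1 * Λ ^ p.2))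
        + (∑ p ∈ antidiagonal K, min (R₁ * gs K p.1 ^ κ₀) (b p.1 * Λ ^ p.2)) + w K)
      (fun K => Cw * ∑ j ∈ Icc (K - m K) K, b j * Λ ^ (K - j) + s' K))
    (K : ℕ) {t : ℝ} (ht : |t| ≤ l₀) :
    |genFun Z K t - genFunLim Z t| ≤
      2 * (vol * ((((∑ p ∈ antidiagonal K, min (E₁ * a ^ p.2) (b p.1 * Λ ^ p.2))
            + (∑ p ∈ antidiagonal K, min (R₁ * gs K p.1 ^ κ₀) (b p.1 * Λ ^ p.2)) + w K) + u K)
            + ((Cw * ∑ j ∈ Icc (K - m K) K, b j * Λ ^ (K - j) + s' K) + s₂ K))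
          - Real.log (1 - V * r₀ ^ m K)) := by
  -- King's matching shape with the hybrid remainder, from the good clause of the re-indexed budget (per pair, n-uniform)
  have hmatch := kingMatching_of_goodClause (W := fun K => V * r₀ ^ m K) hvol T A B Bad hBad hA hB hbadA hbadB hW1 hZA hZB hpos
    fun n => goodClause_of_reindexed (hRB n)
  -- the hybrid remainder tends to zero (the qualitative END's inputs), so the limit exists and the tail bound applies
  have hr := DirectPairingCrossover.tendsto_kingCrossover hE₁ ha0 ha1 hΛ hb₀ h031 hgs hR₁ hκ hb0 hb hw
  have hs : Tendsto (fun K => Cw * ∑ j ∈ Icc (K - m K) K, b j * Λ ^ (K - j) + s' K) atTop (𝓝 0) := by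
    simpa using (hwin.const_mul Cw).add hs'
  have hδ := tendsto_hybridDelta (vol := vol) (tendsto_reindexedDelta hr hu hs hs₂) hWm
  have h1 := abs_genFun_sub_lim_le_of_unif hmatch hl₀ hδ ht K
  rw [mul_hybridDelta hvol.ne'] at h1
  exact h1

/-! ## §2 … with the crossover slot bounded by the interpolation inequality (C44 (a)) -/

/-- **THE E-SIDE END, EFFECTIVE.**  Under the hypotheses of `abs_genFun_sub_lim_le_hybrid` and for every UV cut `N` and every `β ≥ 0` bounding the profile on
the recent window `K − N ≤ j ≤ K`:
`∣genFun Z K t − genFunLim Z t∣ ≤ 2·(vol·(E₁a^{N+1}∕(1−a) + Σ_{i≥0}R₁(b₀(i+N+1))^{−κ₀∕2} + 2β·Σ_{n≤N}Λⁿ + w K + u K + (Cw·Σ_{j=K−m K}^{K} b_jΛ^{K−j} + s′ K) + s₂ K) − log(1 − V·r₀^{m K}))`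
— the E-side enters only through `β` and the window sum; `w, u, s′, s₂` are the T4-DAG owners' rates, `V·r₀^{m K}` NE7b's bad-class budget along the King
window.  (`…Effective.crossoverE_le_window` ∕ `crossoverR_le_window` in §1's radius slot.)  CONDITIONAL kernel theorem on hypothesis SHAPES.
[cite: King1986, p. 657] [folklore] -/
theorem abs_genFun_sub_lim_le_end (hvol : 0 < vol) (hl₀ : 0 ≤ l₀)
    (hb0 : ∀ j, 0 ≤ b j) (hb : Tendsto b atTop (𝓝 0)) (hE₁ : 0 ≤ E₁) (ha0 : 0 ≤ a) (ha1 : a < 1) (hΛ : 0 ≤ Λ)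
    (hb₀ : 0 < b₀) (h031 : ∀ K, Step.Discrete031 b₀ β' K (g K) (gs K)) (hgs : ∀ K k, k ≤ K → 0 ≤ gs K k)
    (hR₁ : 0 ≤ R₁) (hκ : 2 < κ₀)
    (hW1 : ∀ K, V * r₀ ^ m K < 1) (hWm : Tendsto (fun K => V * r₀ ^ m K) atTop (𝓝 0))
    (hwin : Tendsto (fun K => ∑ j ∈ Icc (K - m K) K, b j * Λ ^ (K - j)) atTop (𝓝 0))
    (hw : Tendsto w atTop (𝓝 0)) (hu : Tendsto u atTop (𝓝 0)) (hs' : Tendsto s' atTop (𝓝 0))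
    (hs₂ : Tendsto s₂ atTop (𝓝 0))
    (T : ℕ → ℕ → Finset ι) (A B : ℕ → ℕ → ℝ → ι → ℝ) (Bad : ℕ → ℕ → ℝ → Finset ι)
    (Cc Rr CcRec RrRec : ℕ → ℕ → ℝ → ι → ℝ) (ν c₀ : ℕ → ℕ → ℝ)
    (hZA : ∀ n K t, |t| ≤ l₀ → Z K t = ∑ τ ∈ T n K, A n K t τ)
    (hZB : ∀ n K t, |t| ≤ l₀ → Z (K + n) t = ∑ τ ∈ T n K, B n K t τ)
    (hpos : ∀ n K t, |t| ≤ l₀ → 0 < ∑ τ ∈ T n K, A n K t τ)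
    (hBad : ∀ n K t, |t| ≤ l₀ → Bad n K t ⊆ T n K)
    (hA : ∀ n K t, |t| ≤ l₀ → ∀ τ ∈ T n K, 0 ≤ A n K t τ) (hB : ∀ n K t, |t| ≤ l₀ → ∀ τ ∈ T n K, 0 ≤ B n K t τ)
    (hbadA : ∀ n K t, |t| ≤ l₀ → ∑ τ ∈ Bad n K t, A n K t τ ≤ V * r₀ ^ m K * ∑ τ ∈ T n K, A n K t τ)
    (hbadB : ∀ n K t, |t| ≤ l₀ → ∑ τ ∈ Bad n K t, B n K t τ ≤ V * r₀ ^ m K * ∑ τ ∈ T n K, B n K t τ)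
    (hRB : ∀ n, ReindexedBudget l₀ vol (T n) (A n) (B n) (Bad n) (Cc n) (Rr n) (CcRec n) (RrRec n) (ν n) u s₂ (c₀ n)
      (fun K => (∑ p ∈ antidiagonal K, min (E₁ * a ^ p.2) (b p.1 * Λ ^ p.2))
        + (∑ p ∈ antidiagonal K, min (R₁ * gs K p.1 ^ κ₀) (b p.1 * Λ ^ p.2)) + w K)
      (fun K => Cw * ∑ j ∈ Icc (K - m K) K, b j * Λ ^ (K - j) + s' K))
    {K N : ℕ} {β : ℝ} (hβ0 : 0 ≤ β) (hβ : ∀ j, K - N ≤ j → j ≤ K → b j ≤ β) {t : ℝ} (ht : |t| ≤ l₀) :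
    |genFun Z K t - genFunLim Z t| ≤
      2 * (vol * (E₁ * a ^ (N + 1) / (1 - a)
            + (∑' i : ℕ, R₁ * (b₀ * (((i + (N + 1) : ℕ) : ℝ)))⁻¹ ^ ((κ₀ : ℝ) / 2))
            + 2 * β * (∑ n ∈ range (N + 1), Λ ^ n) + w K + u K
            + (Cw * ∑ j ∈ Icc (K - m K) K, b j * Λ ^ (K - j) + s' K) + s₂ K)
          - Real.log (1 - V * r₀ ^ m K)) := by
  have h1 := abs_genFun_sub_lim_le_hybrid hvol hl₀ hb0 hb hE₁ ha0 ha1 hΛ hb₀ h031 hgs hR₁ hκ hW1 hWm hwin hw hu hs' hs₂ T A B Bad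
    Cc Rr CcRec RrRec ν c₀ hZA hZB hpos hBad hA hB hbadA hbadB hRB K ht
  have hE := crossoverE_le_window (b := b) (K := K) (N := N) hE₁ ha0 ha1 hΛ hβ0 hβ
  have hR := crossoverR_le_window (Λ := Λ) (b := b) (K := K) (N := N) hb₀ h031 hgs hR₁ hκ hΛ hβ0 hβ
  refine h1.trans ?_
  have hsum : (((∑ p ∈ antidiagonal K, min (E₁ * a ^ p.2) (b p.1 * Λ ^ p.2))
            + (∑ p ∈ antidiagonal K, min (R₁ * gs K p.1 ^ κ₀) (b p.1 * Λ ^ p.2)) + w K) + u K)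
            + ((Cw * ∑ j ∈ Icc (K - m K) K, b j * Λ ^ (K - j) + s' K) + s₂ K)
      ≤ E₁ * a ^ (N + 1) / (1 - a)
            + (∑' i : ℕ, R₁ * (b₀ * (((i + (N + 1) : ℕ) : ℝ)))⁻¹ ^ ((κ₀ : ℝ) / 2))
            + 2 * β * (∑ n ∈ range (N + 1), Λ ^ n) + w K + u K
            + (Cw * ∑ j ∈ Icc (K - m K) K, b j * Λ ^ (K - j) + s' K) + s₂ K := by
    linarith
  have hmul := mul_le_mul_of_nonneg_left hsum hvol.le
  linarith

/-! ## §3 The bad-class logarithm is linear on `[0, 1∕2]` -/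

/-- **THE E-SIDE END, EFFECTIVE, EVERY SLOT LINEAR.**  As `abs_genFun_sub_lim_le_end`, with the bad-class budget `0 ≤ V·r₀^{m K} ≤ 1∕2`: the logarithm is
replaced by `2·V·r₀^{m K}`, so `∣genFun Z K t − genFunLim Z t∣ ≤ 2·vol·(slots) + 4·V·r₀^{m K}`. [folklore] -/
theorem abs_genFun_sub_lim_le_end' (hvol : 0 < vol) (hl₀ : 0 ≤ l₀)
    (hb0 : ∀ j, 0 ≤ b j) (hb : Tendsto b atTop (𝓝 0)) (hE₁ : 0 ≤ E₁) (ha0 : 0 ≤ a) (ha1 : a < 1) (hΛ : 0 ≤ Λ)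
    (hb₀ : 0 < b₀) (h031 : ∀ K, Step.Discrete031 b₀ β' K (g K) (gs K)) (hgs : ∀ K k, k ≤ K → 0 ≤ gs K k)
    (hR₁ : 0 ≤ R₁) (hκ : 2 < κ₀)
    (hW1 : ∀ K, V * r₀ ^ m K < 1) (hWm : Tendsto (fun K => V * r₀ ^ m K) atTop (𝓝 0))
    (hwin : Tendsto (fun K => ∑ j ∈ Icc (K - m K) K, b j * Λ ^ (K - j)) atTop (𝓝 0))
    (hw : Tendsto w atTop (𝓝 0)) (hu : Tendsto u atTop (𝓝 0)) (hs' : Tendsto s' atTop (𝓝 0))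
    (hs₂ : Tendsto s₂ atTop (𝓝 0))
    (T : ℕ → ℕ → Finset ι) (A B : ℕ → ℕ → ℝ → ι → ℝ) (Bad : ℕ → ℕ → ℝ → Finset ι)
    (Cc Rr CcRec RrRec : ℕ → ℕ → ℝ → ι → ℝ) (ν c₀ : ℕ → ℕ → ℝ)
    (hZA : ∀ n K t, |t| ≤ l₀ → Z K t = ∑ τ ∈ T n K, A n K t τ)
    (hZB : ∀ n K t, |t| ≤ l₀ → Z (K + n) t = ∑ τ ∈ T n K, B n K t τ)
    (hpos : ∀ n K t, |t| ≤ l₀ → 0 < ∑ τ ∈ T n K, A n K t τ)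
    (hBad : ∀ n K t, |t| ≤ l₀ → Bad n K t ⊆ T n K)
    (hA : ∀ n K t, |t| ≤ l₀ → ∀ τ ∈ T n K, 0 ≤ A n K t τ) (hB : ∀ n K t, |t| ≤ l₀ → ∀ τ ∈ T n K, 0 ≤ B n K t τ)
    (hbadA : ∀ n K t, |t| ≤ l₀ → ∑ τ ∈ Bad n K t, A n K t τ ≤ V * r₀ ^ m K * ∑ τ ∈ T n K, A n K t τ)
    (hbadB : ∀ n K t, |t| ≤ l₀ → ∑ τ ∈ Bad n K t, B n K t τ ≤ V * r₀ ^ m K * ∑ τ ∈ T n K, B n K t τ)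
    (hRB : ∀ n, ReindexedBudget l₀ vol (T n) (A n) (B n) (Bad n) (Cc n) (Rr n) (CcRec n) (RrRec n) (ν n) u s₂ (c₀ n)
      (fun K => (∑ p ∈ antidiagonal K, min (E₁ * a ^ p.2) (b p.1 * Λ ^ p.2))
        + (∑ p ∈ antidiagonal K, min (R₁ * gs K p.1 ^ κ₀) (b p.1 * Λ ^ p.2)) + w K)
      (fun K => Cw * ∑ j ∈ Icc (K - m K) K, b j * Λ ^ (K - j) + s' K))
    {K N : ℕ} {β : ℝ} (hβ0 : 0 ≤ β) (hβ : ∀ j, K - N ≤ j → j ≤ K → b j ≤ β)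
    (hV0 : 0 ≤ V * r₀ ^ m K) (hVhalf : V * r₀ ^ m K ≤ 1 / 2) {t : ℝ} (ht : |t| ≤ l₀) :
    |genFun Z K t - genFunLim Z t| ≤
      2 * (vol * (E₁ * a ^ (N + 1) / (1 - a)
            + (∑' i : ℕ, R₁ * (b₀ * (((i + (N + 1) : ℕ) : ℝ)))⁻¹ ^ ((κ₀ : ℝ) / 2))
            + 2 * β * (∑ n ∈ range (N + 1), Λ ^ n) + w K + u K
            + (Cw * ∑ j ∈ Icc (K - m K) K, b j * Λ ^ (K - j) + s' K) + s₂ K))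
        + 4 * (V * r₀ ^ m K) := by
  have h1 := abs_genFun_sub_lim_le_end hvol hl₀ hb0 hb hE₁ ha0 ha1 hΛ hb₀ h031 hgs hR₁ hκ hW1 hWm hwin hw hu hs' hs₂ T A B Bad
    Cc Rr CcRec RrRec ν c₀ hZA hZB hpos hBad hA hB hbadA hbadB hRB hβ0 hβ ht (N := N)
  -- `−log(1 − x) ≤ 2x` on `[0, 1∕2]` (the tree's `DFI1995.neg_log_one_sub_le`, re-derived inline to keep the import cone topic-local)
  have hpos' : 0 < 1 - V * r₀ ^ m K := by linarith
  have hlog1 := Real.one_sub_inv_le_log_of_pos hpos'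
  have hinv : (1 - V * r₀ ^ m K)⁻¹ ≤ 1 + 2 * (V * r₀ ^ m K) := by
    rw [inv_eq_one_div, div_le_iff₀ hpos']
    nlinarith
  have hlog : -Real.log (1 - V * r₀ ^ m K) ≤ 2 * (V * r₀ ^ m K) := by linarith
  linarith

end End

end Summit.QuantumFields.BalabanUV.T4Continuum.NE9.DirectPairingEndEffective
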